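import Literature.IUT.LogVolume.Corollary22PartIIUpTo
import Literature.IUT.LogVolume.Corollary22PartIII
import Literature.IUT.LogVolume.Corollary22PartIAll
import Literature.IUT.LogVolume.Corollary22GaloisImage
import Literature.IUT.LogVolume.Corollary23Chain
import Literature.IUT.LogVolume.Corollary23JInv
import HarnessLib

/-!
# [IUTchIV] Cor. 2.2 ⟹ Vojta on compactly bounded sets IN BOUNDED DEGREE (the `d ≤ d₀` clauses of [GenEll]
# Thm. 2.1 (ii) at `Σ = {2}`), from Theorem 1.10's display at points of degree `≤ d₀` only

Mochizuki, *Inter-universal Teichmüller theory IV*, RIMS manuscript (Apr. 2020; = PRIMS **57** (2021)), Cor. 2.2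
(pp. 41–43), proof of Cor. 2.3 (p. 55: "(∗^{j-inv}) … is entirely vacuous … for a fixed `d`"); [GenEll] Thm. 2.1
(ii) (MochizukiGenEll2010 p. 11: "for every positive integer `d` … compactly bounded subset `K_V` … whose support
contains `Σ`").

The tree's chain `Corollary22 H_unif → JInvVacuous → ABCCompactlyBounded {2}` (abc-iut-S3/S-d2,
`Corollary23Chain.lean`) is POINTWISE IN THE DEGREE `d`. This file threads a degree bound `d₀` through it:

* `Cor22.vojtaIneq_of_partIIUpTo` — Cor. 2.2 (i) + (ii) in degree `≤ d₀` (`PartIIUpTo`) + (iii) give Vojta's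
  inequality of BD-classes `ht ≲ (1+ε)(log-diff + log-cond)` on `K_V ∩ U_P(ℚ̄)^{≤d}` for every `1 ≤ d ≤ d₀`,
  `ε > 0` (abc-iut-S3's `bdLe_of_corollary22` verbatim with two uniform constants);
* **`Cor22.vojtaIneq_two_of_thm110LegendreUpTo`** — from `Thm110LegendreUpTo d₀` ALONE (the classical inputs
  being THEOREMS: `partI_holds`, `fullGaloisImage_holds`, `exists_threshold_partIII_of_partI`, `jInvVacuous_holds`):
  **for every `1 ≤ d ≤ d₀`, `ε > 0` and every compactly bounded `K_V ⊆ U_P(ℚ̄)` whose support contains `2`,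
  Vojta's inequality holds on `K_V ∩ U_P(ℚ̄)^{≤d}`** — i.e. the degree-`≤ d₀` clauses of [GenEll] Thm. 2.1 (ii) at
  `Σ = {2}` (`ABCCompactlyBounded {2}` restricted to `d ≤ d₀`).

At `d₀ = 1` this is the cell's «d = 1 cut»: Szpiro/Vojta with the printed `(1+ε)` for all RATIONAL points `λ` of
the `λ`-line in a compactly bounded region at `{2, ∞}` (for the Frey–Legendre parameter `λ = a/c` of an abc triple:
`a ≍ b ≍ c` and `v₂(abc)` bounded — itself an open Diophantine statement), kernel-reduced to Thm. 1.10's display at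
DEGREE-1 points, where `F_mod = ℚ`, `d_mod = 1`, and the tensor-packet collections of [IUTchIV] Step (v) are
slot-constant. TAKES NO SIDE on [IUTchIII] Cor. 3.12: `Thm110LegendreUpTo` is a HYPOTHESIS, by name.
-/

noncomputable section

namespace Literature.IUT.LogVolume

namespace Cor22

open NumberField Real
open Literature.NumberTheory.DiophantineGeometry Literature.NumberTheory.DiophantineGeometry.GenEll

/-- **Vojta on `K_V ∩ U_P(ℚ̄)^{≤d}` for `1 ≤ d ≤ d₀`** from Cor. 2.2 (i), (ii)-in-degree-`≤ d₀` and (iii) (the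
Cor. 2.2 step of the proof of Cor. 2.3, p. 55): abc-iut-S3's `bdLe_of_corollary22` verbatim, with the (ii)- and
(iii)-constants allowed to differ. [claim: Mochizuki2012, status: disputed] -/
theorem vojtaIneq_of_partIIUpTo {D : CBData} {Hunif Hunif' : ℝ} {d₀ : ℕ} (hI : PartI D)
    (hII : PartIIUpTo D Hunif d₀) (hIII : PartIII D Hunif') {d : ℕ} (hd : 1 ≤ d) (hdd₀ : d ≤ d₀) {ε : ℝ}
    (hε : 0 < ε) : VojtaIneq D.toSet d ε := by
  obtain ⟨CK, HK, hCKpos, _, hII⟩ := hII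
  obtain ⟨HK₃, _, hIII⟩ := hIII
  set ε' : ℝ := min ε 1 with hε'
  have hε'0 : 0 < ε' := lt_min hε one_pos
  have hε'1 : ε' ≤ 1 := min_le_right _ _
  have hε'ε : ε' ≤ ε := min_le_left _ _
  obtain ⟨Exc₁, -, -, -, hB₁, hC⟩ := hII d hd hdd₀ 1 one_pos le_rfl
  obtain ⟨Exc₂, -, -, hB₂, hE⟩ := hIII d hd 1 one_pos le_rfl ε' hε'0 hε'1
  obtain ⟨_, h12, h23⟩ := hI
  have hht : BDLe D.toSet NFPoint.ht (fun P => 1 / 6 * logQForall P) :=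
    (h23.symm.trans h12.symm).bdLe
  obtain ⟨C₀, hC₀⟩ := hht
  set B₁ : ℝ := Hunif * (1 : ℝ) ^ (-(3 : ℝ)) * (d : ℝ) ^ (4 + (1 : ℝ)) + HK with hB₁def
  set B₂ : ℝ := Hunif' * ε' ^ (-(3 : ℝ)) * (1 : ℝ) ^ (-(3 : ℝ)) * (d : ℝ) ^ (4 + (1 : ℝ)) + HK₃ with hB₂def
  refine ⟨C₀ + CK + (|B₁| + |B₂|) / 6, fun P hP => ?_⟩
  obtain ⟨hPD, hPd⟩ := hP
  have h0 := hC₀ P hPD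
  have hLC : 0 ≤ P.logDiff + P.logCond := add_nonneg P.logDiff_nonneg P.logCond_nonneg
  have hε1 : 0 ≤ (1 + ε) * (P.logDiff + P.logCond) := mul_nonneg (by linarith) hLC
  have hCK : 0 ≤ CK := le_of_lt hCKpos
  have hA₁ : B₁ ≤ |B₁| := le_abs_self _
  have hA₂ : B₂ ≤ |B₂| := le_abs_self _
  have hA₁' : 0 ≤ |B₁| := abs_nonneg _
  have hA₂' : 0 ≤ |B₂| := abs_nonneg _
  simp only at h0 ⊢
  by_cases hP1 : P ∈ Exc₁
  · have hq : logQForall P ≤ B₁ := hB₁ P hP1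
    linarith
  by_cases hP2 : P ∈ Exc₂
  · have hq : logQForall P ≤ B₂ := hB₂ P hP2
    linarith
  obtain ⟨l, -, -, -, -, -, -, hC2⟩ := hC P ⟨hPD, hPd⟩ hP1
  have hεE : epsilonE d P ≤ ε' := hE P ⟨hPD, hPd⟩ hP2
  have hmono : (1 + epsilonE d P) * (P.logDiff + P.logCond) ≤ (1 + ε) * (P.logDiff + P.logCond) :=
    mul_le_mul_of_nonneg_right (by linarith) hLC
  linarith

/-- **The degree-`≤ d₀` clauses of [GenEll] Thm. 2.1 (ii) at `Σ = {2}` from `Thm110LegendreUpTo d₀` alone**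
(the proof of [IUTchIV] Cor. 2.3, p. 55, in bounded degree): for every `1 ≤ d ≤ d₀`, `ε > 0` and every compactly
bounded `K_V ⊆ U_P(ℚ̄)` whose support contains `2`, Vojta's inequality `ht ≲ (1+ε)(log-diff + log-cond)` holds on
`K_V ∩ U_P(ℚ̄)^{≤d}`. Classical inputs DISCHARGED: Cor. 2.2 (i) (`partI_holds`), (iii) (`exists_threshold_partIII_of_partI`),
the Galois-image input (`fullGaloisImage_holds`), the vacuity remark (`jInvVacuous_holds`). CONDITIONAL on the named
hypothesis `Thm110LegendreUpTo d₀` (disputed chain); nothing asserted. [claim: Mochizuki2012, status: disputed] -/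
theorem vojtaIneq_two_of_thm110LegendreUpTo {d₀ : ℕ} (h110 : Thm110LegendreUpTo d₀) :
    ∀ d : ℕ, 0 < d → d ≤ d₀ → ∀ ε : ℝ, 0 < ε → ∀ D : CBData, D.SupportContains {2} →
      VojtaIneq D.toSet d ε := by
  intro d hd hdd₀ ε hε D hD
  obtain ⟨D', hD', hsub⟩ := jInvVacuous_holds D hD d hd
  obtain ⟨HII, hII⟩ := exists_partIIUpTo_of_thm110LegendreUpTo h110 fullGaloisImage_holds
  obtain ⟨H₃, _, h3⟩ := exists_threshold_partIII_of_partI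
  have hI : PartI D' := partI_holds D' hD'
  have h := vojtaIneq_of_partIIUpTo hI (hII D' hD') (h3 D' hI H₃ le_rfl) hd hdd₀ hε
  unfold VojtaIneq at h ⊢
  exact h.mono fun P hP => ⟨hsub hP, hP.2⟩

/-- **The «d = 1 cut»**: from Theorem 1.10's display at DEGREE-1 points only (`Thm110LegendreUpTo 1`: `λ ∈ ℚ`,
`F_mod = ℚ`, `d_mod = 1`), Vojta's inequality for every `ε > 0` on the RATIONAL points of every compactly bounded
`K_V ⊆ U_P(ℚ̄)` whose support contains `2`. CONDITIONAL; nothing asserted; no side taken on [IUTchIII] Cor. 3.12.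
[claim: Mochizuki2012, status: disputed] -/
theorem vojtaIneq_two_degOne_of_thm110LegendreUpTo_one (h110 : Thm110LegendreUpTo 1) {ε : ℝ} (hε : 0 < ε)
    (D : CBData) (hD : D.SupportContains {2}) : VojtaIneq D.toSet 1 ε :=
  vojtaIneq_two_of_thm110LegendreUpTo h110 1 one_pos le_rfl ε hε D hD

end Cor22

end Literature.IUT.LogVolume

end
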